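import Literature.NumberTheory.GaloisRepresentations.IdeleLocalInvariantReadoutArch
import HarnessLib

/-!
# The global invariant of an idèle class as ONE sum over a finite set of PLACES (finite and infinite together);
# the archimedean invariants vanish at odd torsion order and over a totally complex base (Tate, C–F VII §11.2)

Topic `NumberTheory/GaloisRepresentations`; namespace `Literature.NumberTheory.GaloisRepresentations.IdeleCohomology`.
Theorems only (no definition, no named fact, no instance, no notation, no `sorry`); number fields in `Type`.  Sequel to
door-c5's `IdeleLocalInvariants.lean` (`inv E c = (∑ᶠ_v localInv E v c) + Σ_{v∣∞} localInvInf E v c`, `inv_eq_sum` over a finite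
set of FINITE places plus all infinite places) and door-c4 g18's `IdeleLocalInvariantReadoutArch.lean` (`two_nsmul_localInvInf`).

WHY.  The reciprocity sum of the presentation road to Milne I Thm. 4.10 (door-c5's
`poitouTate_selmerStructure_duality_of_reciprocitySum`, door-c6's `…_of_globalTerms_of_imp`) is indexed by a finite set
`T' : Finset (Place K)` of places of BOTH kinds (`Place K = InfinitePlace K ⊕ HeightOneSpectrum (𝓞 K)`, summand `Sum.elim …`);
the E-side value is `inv E β`.  This file rewrites `inv E β` in exactly that indexing and records when the archimedean summands drop out.

* `sum_place_eq_sum_univ_add_sum_toRight` — a sum over `T' ⊇ {all infinite places}` splits as the sum over ALL infinite places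
  plus the sum over the finite places in `T'`.
* **`inv_eq_sum_place`** — `inv E c = Σ_{v ∈ T'} Sum.elim (w ↦ localInvInf E w c) (v ↦ localInv E v c) v` for every finite
  `T' ⊆ Place F` containing all infinite places and the support of the finite invariants.
* `localInvInf_eq_zero_of_odd_nsmul_eq_zero` — `n` odd and `n • c = 0` ⟹ `localInvInf E w c = 0` (the archimedean invariant is
  `2`-torsion); `localInvInf_eq_zero_of_isTotallyComplex`.
* **`inv_eq_sum_place_of_forall_localInvInf_eq_zero`**, **`inv_eq_sum_place_of_isTotallyComplex`**,
  **`inv_eq_sum_place_of_odd`** — the same identity WITHOUT requiring the infinite places to lie in `T'` when the archimedean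
  invariants vanish (totally complex base; odd torsion order).

HONEST FRAMING: bookkeeping; no arithmetic beyond the cited files, no case of Poitou–Tate or BSD.  Route A (R4) of crux
`AnticycControlAdditiveK` (item 19295, cell bsd-schneider): the E-side of the reciprocity sum in place-indexed form, for the
assembly over a totally complex base (door-c6 g18 (L2)) and over a general base (door-c4 g18, archimedean lane).

## References
* J. W. S. Cassels, A. Fröhlich (eds.), *Algebraic Number Theory* (1967), Ch. VII (J. Tate) §7.3 Cor. 7.4 (b), §11.2.
  [CasselsFrohlichANT1967]
* J. S. Milne, *Arithmetic Duality Theorems*, 2nd ed. (2006), I Ex. 1.6 (c), Thm. 4.10 (proof). [MilneADT2006]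
-/

noncomputable section

open NumberField NumberField.InfinitePlace IsDedekindDomain CategoryTheory groupCohomology Function Field
open Literature.NumberTheory.Automorphic

namespace Literature.NumberTheory.GaloisRepresentations

namespace IdeleCohomology

variable {F : Type} [Field F] [NumberField F] {E : Type} [Field E] [NumberField E] [Algebra F E] [IsGalois F E]

/-- A sum over a finite set of places containing ALL infinite places splits as the sum over all infinite places plus the sum
over its finite places. [cite: CasselsFrohlichANT1967, Ch. VII §11.2] -/
theorem sum_place_eq_sum_univ_add_sum_toRight {A : Type*} [AddCommMonoid A] (T' : Finset (Place F))
    (hinf : ∀ w : InfinitePlace F, (Sum.inl w : Place F) ∈ T') (g : Place F → A) :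
    ∑ v ∈ T', g v = (∑ w : InfinitePlace F, g (Sum.inl w)) + ∑ v ∈ T'.toRight, g (Sum.inr v) := by
  rw [Finset.sum_sum_eq_sum_toLeft_add_sum_toRight]
  congr 1
  refine Finset.sum_congr ?_ fun _ _ => rfl
  ext w
  simp only [Finset.mem_toLeft, Finset.mem_univ, iff_true]
  exact hinf w

/-- **`inv E c` as ONE sum over places**: for every finite `T' ⊆ Place F` containing all infinite places and every finite place at
which the local invariant of `c` is non-zero,
`inv E c = Σ_{v ∈ T'} Sum.elim (w ↦ localInvInf E w c) (v ↦ localInv E v c) v`. [cite: CasselsFrohlichANT1967, Ch. VII §11.2] -/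
theorem inv_eq_sum_place (c : groupCohomology (IdeleClassGroup.ideleRep F E) 2) (T' : Finset (Place F))
    (hinf : ∀ w : InfinitePlace F, (Sum.inl w : Place F) ∈ T')
    (hT : ∀ v : HeightOneSpectrum (𝓞 F), (Sum.inr v : Place F) ∉ T' → localInv E v c = 0) :
    inv E c = ∑ v ∈ T', Sum.elim (fun w => localInvInf E w c) (fun v => localInv E v c) v := by
  rw [sum_place_eq_sum_univ_add_sum_toRight T' hinf, inv_eq_sum c T'.toRight (fun v hv => hT v (by
    rwa [Finset.mem_toRight] at hv)), add_comm]
  rfl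

/-- **At odd torsion order the archimedean invariants vanish**: `n` odd, `n • c = 0` ⟹ `localInvInf E w c = 0`
(`localInvInf E w c` is `2`-torsion, `two_nsmul_localInvInf`). [cite: MilneADT2006, Ch. I, Ex. 1.6 (c)]
[cite: CasselsFrohlichANT1967, Ch. VII §7.3 Cor. 7.4 (b)] -/
theorem localInvInf_eq_zero_of_odd_nsmul_eq_zero {n : ℕ} (hn : Odd n) (c : groupCohomology (IdeleClassGroup.ideleRep F E) 2)
    (hc : n • c = 0) (w : InfinitePlace F) : localInvInf E w c = 0 := by
  obtain ⟨k, rfl⟩ := hn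
  have h2 := two_nsmul_localInvInf (E := E) w c
  have hn : (2 * k + 1) • localInvInf E w c = 0 := by rw [← map_nsmul, hc, map_zero]
  rwa [add_nsmul, one_nsmul, mul_comm, mul_nsmul', h2, nsmul_zero, zero_add] at hn

/-- Over a totally complex base every archimedean invariant vanishes. [cite: CasselsFrohlichANT1967, Ch. VII §7.3 Cor. 7.4 (b)] -/
theorem localInvInf_eq_zero_of_isTotallyComplex [IsTotallyComplex F] (w : InfinitePlace F)
    (c : groupCohomology (IdeleClassGroup.ideleRep F E) 2) : localInvInf E w c = 0 :=
  localInvInf_eq_zero_of_isComplex (IsTotallyComplex.isComplex w) c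

/-- **`inv E c` as a sum over ANY finite set of places containing the support of the finite invariants, when all archimedean
invariants of `c` vanish** (the infinite places of `T'` contribute `0`, the others are not needed).
[cite: CasselsFrohlichANT1967, Ch. VII §11.2] -/
theorem inv_eq_sum_place_of_forall_localInvInf_eq_zero (c : groupCohomology (IdeleClassGroup.ideleRep F E) 2)
    (hc : ∀ w : InfinitePlace F, localInvInf E w c = 0) (T' : Finset (Place F))
    (hT : ∀ v : HeightOneSpectrum (𝓞 F), (Sum.inr v : Place F) ∉ T' → localInv E v c = 0) :
    inv E c = ∑ v ∈ T', Sum.elim (fun w => localInvInf E w c) (fun v => localInv E v c) v := by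
  rw [Finset.sum_sum_eq_sum_toLeft_add_sum_toRight, inv_eq_sum c T'.toRight (fun v hv => hT v (by
    rwa [Finset.mem_toRight] at hv)), add_comm]
  have h1 : ∑ v : InfinitePlace F, localInvInf E v c = 0 := Finset.sum_eq_zero fun w _ => hc w
  have h2 : ∑ x ∈ T'.toLeft, Sum.elim (fun w => localInvInf E w c) (fun v => localInv E v c) (Sum.inl x) = 0 :=
    Finset.sum_eq_zero fun w _ => hc w
  rw [h1, h2]
  rfl

/-- **Totally complex base**: `inv E c = Σ_{v ∈ T'} Sum.elim (localInvInf E · c) (localInv E · c) v` for every finite `T'`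
containing the support of the finite invariants. [cite: CasselsFrohlichANT1967, Ch. VII §11.2] -/
theorem inv_eq_sum_place_of_isTotallyComplex [IsTotallyComplex F] (c : groupCohomology (IdeleClassGroup.ideleRep F E) 2)
    (T' : Finset (Place F)) (hT : ∀ v : HeightOneSpectrum (𝓞 F), (Sum.inr v : Place F) ∉ T' → localInv E v c = 0) :
    inv E c = ∑ v ∈ T', Sum.elim (fun w => localInvInf E w c) (fun v => localInv E v c) v :=
  inv_eq_sum_place_of_forall_localInvInf_eq_zero c (fun w => localInvInf_eq_zero_of_isTotallyComplex w c) T' hT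

/-- **Odd torsion order, any base**: `inv E c = Σ_{v ∈ T'} Sum.elim (localInvInf E · c) (localInv E · c) v` for `n` odd, `n • c = 0`
and every finite `T'` containing the support of the finite invariants. [cite: CasselsFrohlichANT1967, Ch. VII §11.2]
[cite: MilneADT2006, Ch. I, Ex. 1.6 (c)] -/
theorem inv_eq_sum_place_of_odd {n : ℕ} (hn : Odd n) (c : groupCohomology (IdeleClassGroup.ideleRep F E) 2) (hc : n • c = 0)
    (T' : Finset (Place F)) (hT : ∀ v : HeightOneSpectrum (𝓞 F), (Sum.inr v : Place F) ∉ T' → localInv E v c = 0) :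
    inv E c = ∑ v ∈ T', Sum.elim (fun w => localInvInf E w c) (fun v => localInv E v c) v :=
  inv_eq_sum_place_of_forall_localInvInf_eq_zero c (localInvInf_eq_zero_of_odd_nsmul_eq_zero hn c hc) T' hT

omit [NumberField F] in
/-- The infinite summands of the place-indexed sum all vanish over a totally complex base, so the sum equals its finite part.
[cite: CasselsFrohlichANT1967, Ch. VII §11.2] -/
theorem sum_place_elim_eq_sum_toRight_of_isTotallyComplex [IsTotallyComplex F] {A : Type*} [AddCommMonoid A]
    (T' : Finset (Place F)) (g₁ : InfinitePlace F → A) (g₂ : HeightOneSpectrum (𝓞 F) → A)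
    (hg₁ : ∀ w : InfinitePlace F, w.IsComplex → g₁ w = 0) :
    ∑ v ∈ T', Sum.elim g₁ g₂ v = ∑ v ∈ T'.toRight, g₂ v := by
  rw [Finset.sum_sum_eq_sum_toLeft_add_sum_toRight]
  have h : ∑ x ∈ T'.toLeft, Sum.elim g₁ g₂ (Sum.inl x) = 0 :=
    Finset.sum_eq_zero fun w _ => hg₁ w (IsTotallyComplex.isComplex w)
  rw [h, zero_add]
  rfl

end IdeleCohomology

end Literature.NumberTheory.GaloisRepresentations

end
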